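import Mathlib

/-!
# Lemma P (projection) — the linear algebra the Weil model needs, kernel-checked

Blind re-derivation cell `pub-hodge-repro`, seat `night-3` (gen 2).  Mathlib only.  Namespace `HodgeRepro.Night3.LemmaP`.

The route (route/lattice-lead-g18/LEMMA-L-P-v2.md, Lemma P) proves S4 for a corner product from S4 for its pieces in three
steps: (1) the Künneth inclusion `W_F(Y) ⊂ ⊗_k W_F(Y_k)`, (2) a rational witness `y` with `Q′(w′_σ, y) ≠ 0` for every `σ`,
(3) the projection `Φ(w_σ ⊗ w′_σ) = c_σ · w_σ`, hence `Φ(W_F(X)) = W_F(B_M)`.  typer-2's candidate files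
`interface/typer-2/candidates/LemmaPLinear.lean` (sha256-16 4abdb84e534c10b2), `LemmaPKunneth.lean` (e7a37436a9e07971),
`LemmaPProjection.lean` (07f772ceb683bfa3) and `LemmaPWitness.lean` (b5e24ba33db1c755) proved the linear algebra of those
steps for an arbitrary field extension `K ⊆ L` (`ℚ ⊆ ℂ`); they are NOT in the tree.  This file restates, with the same
proofs, exactly the lemmas that `Night3WeilModel` consumes — **typer-2's work, attributed here declaration by declaration;
to be retired in favour of the imports the moment those candidates land** — and adds ONE new lemma:

* `exists_mem_forall_ne_zero` — the rational witness INSIDE a `K`-subspace `W ≤ H`: finitely many `L`-linear functionals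
  on `L ⊗[K] H`, each non-zero somewhere on `W ⊗ L`, all miss some rational `y ∈ W` (`K` infinite).  typer-2's
  `exists_forall_ne_zero` has `W` = the whole space; the Weil space `W_F(B′)` is a SUBSPACE of `H^•(B′, ℚ)` and the form
  `Q′` lives on the whole cohomology, which is the shape the model needs.

Nothing here is a sealed-statement proof; the file touches no sealed file and no Tier-2 item depends on it.
-/

set_option autoImplicit false

open TensorProduct

namespace HodgeRepro.Night3.LemmaP

section Descent

variable {K L : Type*} [Field K] [Field L] [Algebra K L]
variable {W : Type*} [AddCommGroup W] [Module K W]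

/-- The `L`-linear functional on `L ⊗[K] W` extending a `K`-linear functional `f : W → K`: `a ⊗ₜ w ↦ a * f w`.
(typer-2, LemmaPLinear `extendDual`.) -/
noncomputable def extendDual (f : Module.Dual K W) : L ⊗[K] W →ₗ[L] L :=
  TensorProduct.AlgebraTensorModule.lift
    (LinearMap.toSpanSingleton L (W →ₗ[K] L) ((Algebra.linearMap K L) ∘ₗ f))

/-- `extendDual` on pure tensors.  (typer-2, LemmaPLinear.) -/
theorem extendDual_tmul (f : Module.Dual K W) (a : L) (w : W) :
    extendDual (L := L) f (a ⊗ₜ w) = a * algebraMap K L (f w) := by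
  simp [extendDual, LinearMap.toSpanSingleton_apply]

/-- A functional vanishing on `U` extends to one vanishing on the base change `U ⊗ L`.  (typer-2, LemmaPLinear.) -/
theorem extendDual_eq_zero_of_mem {U : Submodule K W} {f : Module.Dual K W} (hf : ∀ u ∈ U, f u = 0)
    {x : L ⊗[K] W} (hx : x ∈ U.baseChange L) : extendDual (L := L) f x = 0 := by
  have hle : U.baseChange L ≤ LinearMap.ker (extendDual (L := L) f) := by
    rw [Submodule.baseChange_eq_span, Submodule.span_le]
    rintro _ ⟨u, hu, rfl⟩
    simp [extendDual_tmul, hf u hu]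
  exact hle hx

/-- **Descent of inclusions** (Lemma P, steps (1) and (3)): `V ⊗ L ⊆ U ⊗ L` forces `V ⊆ U`.
(typer-2, LemmaPLinear `le_of_baseChange_le`.) -/
theorem le_of_baseChange_le {V U : Submodule K W} (h : V.baseChange L ≤ U.baseChange L) : V ≤ U := by
  intro v hv
  by_contra hvU
  obtain ⟨f, hfv, hfU⟩ := U.exists_dual_map_eq_bot_of_notMem hvU inferInstance
  have hf : ∀ u ∈ U, f u = 0 := fun u hu => by
    have : f u ∈ U.map f := Submodule.mem_map_of_mem hu
    rwa [hfU, Submodule.mem_bot] at this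
  have h0 := extendDual_eq_zero_of_mem (L := L) hf (h (Submodule.tmul_mem_baseChange_of_mem 1 hv))
  rw [extendDual_tmul, one_mul, map_eq_zero_iff _ (algebraMap K L).injective] at h0
  exact hfv h0

/-- Two subspaces with the same base change are equal (step (3): `Φ(W_F(X)) = W_F(B_M)`).
(typer-2, LemmaPLinear `baseChange_inj`.) -/
theorem baseChange_inj {V U : Submodule K W} (h : V.baseChange L = U.baseChange L) : V = U :=
  le_antisymm (le_of_baseChange_le h.le) (le_of_baseChange_le h.ge)

/-- Step (1) in the form used: if `V ⊗ L` is spanned by vectors `ℓ σ` each lying in `U ⊗ L`, then `V ⊆ U`.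
(typer-2, LemmaPLinear `le_of_baseChange_eq_span`.) -/
theorem le_of_baseChange_eq_span {V U : Submodule K W} {ι : Type*} {ℓ : ι → L ⊗[K] W}
    (hV : V.baseChange L = Submodule.span L (Set.range ℓ)) (hℓ : ∀ σ, ℓ σ ∈ U.baseChange L) : V ≤ U :=
  le_of_baseChange_le (by rw [hV, Submodule.span_le]; rintro _ ⟨σ, rfl⟩; exact hℓ σ)

/-- Step (3): a linear map sending each `x i` to a nonzero multiple `c i • w i` maps the span of the `x i` onto the span
of the `w i`.  (typer-2, LemmaPLinear `map_span_eq_span_of_smul`.) -/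
theorem map_span_eq_span_of_smul {V' : Type*} [AddCommGroup V'] [Module L V'] {V : Type*} [AddCommGroup V]
    [Module L V] {ι : Type*} (Φ : V →ₗ[L] V') (x : ι → V) (w : ι → V') (c : ι → L) (hc : ∀ i, c i ≠ 0)
    (hΦ : ∀ i, Φ (x i) = c i • w i) :
    Submodule.map Φ (Submodule.span L (Set.range x)) = Submodule.span L (Set.range w) := by
  rw [Submodule.map_span]
  apply le_antisymm
  · rw [Submodule.span_le]
    rintro _ ⟨_, ⟨i, rfl⟩, rfl⟩
    rw [hΦ i]
    exact Submodule.smul_mem _ _ (Submodule.subset_span ⟨i, rfl⟩)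
  · rw [Submodule.span_le]
    rintro _ ⟨i, rfl⟩
    have : w i = (c i)⁻¹ • Φ (x i) := by rw [hΦ i, smul_smul, inv_mul_cancel₀ (hc i), one_smul]
    rw [this]
    exact Submodule.smul_mem _ _ (Submodule.subset_span ⟨x i, ⟨i, rfl⟩, rfl⟩)

/-- **The rational witness inside a subspace** (Lemma P, step (2); NEW, night-3 gen 2): `W ≤ H` a `K`-subspace (the Weil
space `W_F(B′)` inside `H^•(B′, ℚ)`), `ψ i` finitely many `L`-linear functionals on `L ⊗[K] H` (`Q′(w′_σ, ·)`), each non-zero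
somewhere on `W ⊗ L`; then some rational `y ∈ W` is outside every kernel: `ψ i (1 ⊗ₜ y) ≠ 0` for all `i` (`K` infinite) —
«the `2m` proper subspaces do not cover the ℚ-space `W_F(B′)`». -/
theorem exists_mem_forall_ne_zero [Infinite K] {ι : Type*} [Fintype ι] (S : Submodule K W)
    (ψ : ι → (L ⊗[K] W →ₗ[L] L)) (hψ : ∀ i, ∃ x ∈ S.baseChange L, ψ i x ≠ 0) :
    ∃ y ∈ S, ∀ i, ψ i (1 ⊗ₜ y) ≠ 0 := by
  classical
  let g : ι → (S →ₗ[K] L) := fun i => (ψ i).restrictScalars K ∘ₗ TensorProduct.mk K L W 1 ∘ₗ S.subtype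
  have hg : ∀ i, LinearMap.ker (g i) ≠ ⊤ := by
    intro i hi
    obtain ⟨x, hx, hx0⟩ := hψ i
    apply hx0
    have hle : S.baseChange L ≤ LinearMap.ker (ψ i) := by
      rw [Submodule.baseChange_eq_span, Submodule.span_le]
      rintro _ ⟨w, hw, rfl⟩
      have : (⟨w, hw⟩ : S) ∈ LinearMap.ker (g i) := by rw [hi]; trivial
      simpa [g] using this
    exact hle hx
  have hcard : (Finset.univ : Finset ι).card < ENat.card K := by
    rw [ENat.card_eq_top_of_infinite]; exact ENat.coe_lt_top _
  have hss := Submodule.iUnion_ssubset_of_forall_ne_top_of_card_lt Finset.univ (fun i => LinearMap.ker (g i)) hg hcard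
  obtain ⟨y, -, hy⟩ := Set.exists_of_ssubset hss
  refine ⟨y, y.2, fun i hi => hy ?_⟩
  simp only [Finset.mem_univ, Set.iUnion_true, Set.mem_iUnion, SetLike.mem_coe, LinearMap.mem_ker]
  exact ⟨i, by simpa [g] using hi⟩

end Descent

section Kunneth

variable {K L : Type*} [Field K] [Field L] [Algebra K L]
variable {W₁ W₂ : Type*} [AddCommGroup W₁] [Module K W₁] [AddCommGroup W₂] [Module K W₂]

/-- The identification `(W₁ ⊗ L) ⊗_L (W₂ ⊗ L) ≅ (W₁ ⊗ W₂) ⊗ L` (`distribBaseChange⁻¹`) on pure tensors: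
`(a ⊗ w₁) ⊗ (b ⊗ w₂) ↦ (b * a) ⊗ (w₁ ⊗ w₂)`.  (typer-2, LemmaPKunneth.) -/
theorem distribBaseChange_symm_tmul (a b : L) (w₁ : W₁) (w₂ : W₂) :
    (AlgebraTensorModule.distribBaseChange K L W₁ W₂).symm ((a ⊗ₜ[K] w₁) ⊗ₜ[L] (b ⊗ₜ[K] w₂)) =
      (b * a) ⊗ₜ[K] (w₁ ⊗ₜ[K] w₂) := by
  simp only [AlgebraTensorModule.distribBaseChange, LinearEquiv.symm_symm, LinearEquiv.trans_apply,
    AlgebraTensorModule.cancelBaseChange_tmul, smul_tmul', smul_eq_mul, AlgebraTensorModule.assoc_tmul]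

/-- **Künneth, the linear algebra** (Lemma P, step (1)): `x₁ ∈ U₁ ⊗ L` and `x₂ ∈ U₂ ⊗ L` give
`x₁ ⊗ x₂ ∈ (U₁ ⊗ U₂) ⊗ L`, the tensor read in `(W₁ ⊗ W₂) ⊗ L` through `distribBaseChange⁻¹`.
(typer-2, LemmaPKunneth `distribBaseChange_symm_tmul_mem`.) -/
theorem distribBaseChange_symm_tmul_mem {U₁ : Submodule K W₁} {U₂ : Submodule K W₂}
    {x₁ : L ⊗[K] W₁} {x₂ : L ⊗[K] W₂} (h₁ : x₁ ∈ U₁.baseChange L) (h₂ : x₂ ∈ U₂.baseChange L) :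
    (AlgebraTensorModule.distribBaseChange K L W₁ W₂).symm (x₁ ⊗ₜ[L] x₂) ∈
      (Submodule.map₂ (TensorProduct.mk K W₁ W₂) U₁ U₂).baseChange L := by
  set T := Submodule.map₂ (TensorProduct.mk K W₁ W₂) U₁ U₂ with hT
  set e := (AlgebraTensorModule.distribBaseChange K L W₁ W₂).symm with he
  have hA : ∀ u₁ ∈ U₁, ∀ x₂ ∈ U₂.baseChange L, e ((1 ⊗ₜ[K] u₁) ⊗ₜ[L] x₂) ∈ T.baseChange L := by
    intro u₁ hu₁ x₂ hx₂
    have hle : U₂.baseChange L ≤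
        (T.baseChange L).comap (e.toLinearMap ∘ₗ TensorProduct.mk L (L ⊗[K] W₁) (L ⊗[K] W₂) (1 ⊗ₜ[K] u₁)) := by
      rw [Submodule.baseChange_eq_span, Submodule.span_le]
      rintro _ ⟨u₂, hu₂, rfl⟩
      simp only [SetLike.mem_coe, Submodule.mem_comap, LinearMap.comp_apply, LinearEquiv.coe_coe,
        TensorProduct.mk_apply]
      rw [he, distribBaseChange_symm_tmul, one_mul]
      exact Submodule.tmul_mem_baseChange_of_mem 1 (Submodule.apply_mem_map₂ _ hu₁ hu₂)
    exact hle hx₂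
  have hle : U₁.baseChange L ≤
      (T.baseChange L).comap (e.toLinearMap ∘ₗ (TensorProduct.mk L (L ⊗[K] W₁) (L ⊗[K] W₂)).flip x₂) := by
    rw [Submodule.baseChange_eq_span, Submodule.span_le]
    rintro _ ⟨u₁, hu₁, rfl⟩
    simp only [SetLike.mem_coe, Submodule.mem_comap, LinearMap.comp_apply, LinearEquiv.coe_coe,
      LinearMap.flip_apply, TensorProduct.mk_apply]
    exact hA u₁ hu₁ x₂ h₂
  exact hle h₁

/-- **Lemma P, step (1), two factors**: `V ⊆ W₁ ⊗ W₂` a `K`-subspace whose base change is spanned by the tensors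
`ℓ₁ σ ⊗ ℓ₂ σ` with `ℓ_k σ ∈ U_k ⊗ L`; then `V ⊆ U₁ ⊗ U₂` — «`W_F(Y) ⊂ W_F(Y₁) ⊗ W_F(Y₂)`».
(typer-2, LemmaPKunneth `le_map₂_of_baseChange_eq_span`.) -/
theorem le_map₂_of_baseChange_eq_span {V : Submodule K (W₁ ⊗[K] W₂)} {U₁ : Submodule K W₁}
    {U₂ : Submodule K W₂} {ι : Type*} {ℓ₁ : ι → L ⊗[K] W₁} {ℓ₂ : ι → L ⊗[K] W₂}
    (hV : V.baseChange L = Submodule.span L (Set.range fun σ =>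
      (AlgebraTensorModule.distribBaseChange K L W₁ W₂).symm (ℓ₁ σ ⊗ₜ[L] ℓ₂ σ)))
    (h₁ : ∀ σ, ℓ₁ σ ∈ U₁.baseChange L) (h₂ : ∀ σ, ℓ₂ σ ∈ U₂.baseChange L) :
    V ≤ Submodule.map₂ (TensorProduct.mk K W₁ W₂) U₁ U₂ :=
  le_of_baseChange_eq_span hV fun σ => distribBaseChange_symm_tmul_mem (h₁ σ) (h₂ σ)

end Kunneth

section Projection

variable {K L : Type*} [Field K] [Field L] [Algebra K L]
variable {X Y : Type*} [AddCommGroup X] [Module K X] [AddCommGroup Y] [Module K Y]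

/-- Base change commutes with the image of a subspace: `(Φ(V)) ⊗ L = Φ_L (V ⊗ L)`.  (typer-2, LemmaPProjection.) -/
theorem baseChange_map (Φ : X →ₗ[K] Y) (V : Submodule K X) :
    (V.map Φ).baseChange L = (V.baseChange L).map (Φ.baseChange L) := by
  rw [Submodule.baseChange_eq_span, Submodule.baseChange_eq_span, Submodule.map_span]
  congr 1
  rw [Submodule.map_coe, Submodule.map_coe, Submodule.map_coe, Set.image_image, Set.image_image]
  refine Set.image_congr fun v _ => ?_
  simp [LinearMap.baseChange_tmul]

/-- **Lemma P, step (3), packaged**: if `Φ_L` sends each `x σ` to `c σ • w σ` with `c σ ≠ 0`, `V ⊗ L` is spanned by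
the `x σ` and `U ⊗ L` by the `w σ`, then `Φ(V) = U` — «`Φ(W_F(X)) = W_F(B_M)`».
(typer-2, LemmaPProjection `map_eq_of_baseChange_span`.) -/
theorem map_eq_of_baseChange_span {V : Submodule K X} {U : Submodule K Y} (Φ : X →ₗ[K] Y) {ι : Type*}
    (x : ι → L ⊗[K] X) (w : ι → L ⊗[K] Y) (c : ι → L) (hc : ∀ i, c i ≠ 0)
    (hΦ : ∀ i, Φ.baseChange L (x i) = c i • w i)
    (hV : V.baseChange L = Submodule.span L (Set.range x))
    (hU : U.baseChange L = Submodule.span L (Set.range w)) : V.map Φ = U :=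
  baseChange_inj (L := L)
    (by rw [baseChange_map, hV, map_span_eq_span_of_smul (Φ.baseChange L) x w c hc hΦ, hU])

variable {X₁ X₂ : Type*} [AddCommGroup X₁] [Module K X₁] [AddCommGroup X₂] [Module K X₂]

/-- The contraction `id ⊗ φ : X₁ ⊗ X₂ → X₁`, `v ⊗ w ↦ φ w • v` — the projection formula's shape of
`Φ = pr_{B_M *}((·) ∪ pr_{B′}^* d′)` in the Künneth model, with `φ = ∫_{B′} (·) ∪ d′`.  (typer-2, LemmaPProjection.) -/
noncomputable def contract (φ : Module.Dual K X₂) : X₁ ⊗[K] X₂ →ₗ[K] X₁ :=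
  (TensorProduct.rid K X₁).toLinearMap ∘ₗ LinearMap.lTensor X₁ φ

/-- `contract` on pure tensors.  (typer-2, LemmaPProjection.) -/
theorem contract_tmul (φ : Module.Dual K X₂) (v : X₁) (w : X₂) : contract φ (v ⊗ₜ[K] w) = φ w • v := by
  simp [contract]

/-- **The projection formula in the Künneth model**: `(id ⊗ φ)_L (x₁ ⊗ x₂) = (extendDual φ x₂) • x₁` for all
`x₁ ∈ X₁ ⊗ L`, `x₂ ∈ X₂ ⊗ L` — «`Φ(w_σ ⊗ w′_σ) = c_σ · w_σ`» with `c_σ = extendDual φ (w′_σ)`.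
(typer-2, LemmaPProjection `baseChange_contract_distribBaseChange_symm_tmul`.) -/
theorem baseChange_contract_distribBaseChange_symm_tmul (φ : Module.Dual K X₂) (x₁ : L ⊗[K] X₁)
    (x₂ : L ⊗[K] X₂) :
    (contract φ).baseChange L ((AlgebraTensorModule.distribBaseChange K L X₁ X₂).symm (x₁ ⊗ₜ[L] x₂)) =
      extendDual (L := L) φ x₂ • x₁ := by
  induction x₁ using TensorProduct.induction_on with
  | zero => simp
  | tmul a v =>
    induction x₂ using TensorProduct.induction_on with
    | zero => simp
    | tmul b w =>
      simp only [distribBaseChange_symm_tmul, LinearMap.baseChange_tmul, contract_tmul, extendDual_tmul,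
        TensorProduct.tmul_smul, TensorProduct.smul_tmul', smul_eq_mul, Algebra.smul_def]
      congr 1
      ring
    | add y z hy hz => rw [TensorProduct.tmul_add, map_add, map_add, hy, hz, map_add, add_smul]
  | add y z hy hz => rw [TensorProduct.add_tmul, map_add, map_add, hy, hz, smul_add]

/-- The `L`-linear extension of the rational functional `E_K (·, y)` is the base-changed form `E_K ⊗ L` paired with
`1 ⊗ y`.  (typer-2, LemmaPWitness `extendDual_flip_eq_baseChange`.) -/
theorem extendDual_flip_eq_baseChange (E : LinearMap.BilinForm K X) (y : X) (x : L ⊗[K] X) :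
    extendDual (L := L) (E.flip y) x = (E.baseChange L) x ((1 : L) ⊗ₜ[K] y) := by
  induction x using TensorProduct.induction_on with
  | zero => simp
  | tmul a w =>
    simp only [extendDual_tmul, LinearMap.BilinForm.flip_apply, LinearMap.BilinForm.baseChange_tmul,
      Algebra.smul_def, mul_one]
    ring
  | add x₁ x₂ h₁ h₂ => simp only [map_add, LinearMap.add_apply, h₁, h₂]

end Projection

end HodgeRepro.Night3.LemmaP
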